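import Summits.BirchSwinnertonDyer.BirchSwinnertonDyer.Theorems.PlecticLegsKatoDescentCore
import Literature.NumberTheory.EllipticCurves.MordellWeilTheoremProofs
import HarnessLib

/-!
# BirchSwinnertonDyer / PlecticLegs — support item `KatoDescent` (stmt-BirchSwinnertonDyer-18262):
# Galois descent of the Mordell–Weil rank from `ℚ(ζ_m)^H` to `ℚ`

For an elliptic curve `E/ℚ` (Weierstrass model `W`), `m ≥ 1`, `K = ℚ(ζ_m)` (Mathlib
`CyclotomicField m ℚ` with its canonical `ℚ`-algebra structure `DivisionRing.toRatAlgebra`, as in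
the route file), `G = Gal(K/ℚ) = (K ≃ₐ[ℚ] K)` acting on `M = E(K)` by transport of coordinates
(Mathlib `WeierstrassCurve.Affine.Point.map`), and `H ≤ G` with fixed field `F = K^H`:

* `mordellWeilRank_fixedField_eq_of_chiPart_torsion` — **if the `χ`-parts `E(K)^(χ)` are torsion
  for all non-trivial characters `χ` of `G` trivial on `H`, then `rank_ℤ E(F) = rank_ℤ E(ℚ)`.**
  Ingredients: `E(F) ↪ E(K)^H` and `E(ℚ) ↪ E(F)` (`Point.map_injective`), `E(K)^G = E(ℚ)`
  (Galois descent of points: a point fixed by `G` has coordinates in `K^G = ℚ`, Mathlib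
  `IsGalois.fixedField_top`), the Mordell–Weil theorem over number fields (tree theorem
  `WeierstrassCurve.module_finite_point_holds`) and the rank algebra
  `KatoDescent.finrank_fixed_eq_finrank_fixed_of_subgroup` (`PlecticLegsKatoDescentCore`).

The torsion hypothesis is what Kato's Cor. 14.3 (2) (Astérisque 295) supplies when
`L(E, χ, 1) ≠ 0`; it is kept abstract here (characters `G →* ℂˣ`), the translation to Dirichlet
characters being done in `PlecticLegsKatoDescent`.
-/

set_option linter.dupNamespace false

noncomputable section

open scoped BigOperators Classical
open Polynomial Literature.NumberTheory.EllipticCurves Module WeierstrassCurve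
  WeierstrassCurve.Affine

namespace Summit.BirchSwinnertonDyer.BirchSwinnertonDyer.Theorems

namespace KatoDescent

set_option backward.isDefEq.respectTransparency false in
/-- `ℚ(ζ_m)/ℚ` is Galois, for the canonical `ℚ`-algebra structure `DivisionRing.toRatAlgebra` on
Mathlib's `CyclotomicField m ℚ` (Mathlib `IsCyclotomicExtension.isGalois`; the option
`backward.isDefEq.respectTransparency false` identifies the two `ℚ`-algebra structures, as in
`Literature.NumberTheory.EllipticCurves.KatoTwistedFiniteness`). [folklore] -/
theorem isGalois_cyclotomicField (m : ℕ) [NeZero m] : IsGalois ℚ (CyclotomicField m ℚ) :=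
  IsCyclotomicExtension.isGalois {m} ℚ (CyclotomicField m ℚ)

set_option backward.isDefEq.respectTransparency false in
/-- `Gal(ℚ(ζ_m)/ℚ)` is commutative, for the canonical `ℚ`-algebra structure on
`CyclotomicField m ℚ` (Mathlib `IsCyclotomicExtension.isMulCommutative`). [folklore] -/
theorem isMulCommutative_gal_cyclotomicField (m : ℕ) [NeZero m] :
    IsMulCommutative (CyclotomicField m ℚ ≃ₐ[ℚ] CyclotomicField m ℚ) :=
  IsCyclotomicExtension.isMulCommutative {m} ℚ (CyclotomicField m ℚ)

open scoped IsMulCommutative in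
/-- **Galois descent of the rank.** Let `E/ℚ` be an elliptic curve, `m ≥ 1`, `K = ℚ(ζ_m)`,
`G = Gal(K/ℚ)` acting on `E(K)` by `σ ↦ Point.map σ`, and `H ≤ G` with fixed field `F = K^H`.
If for every non-trivial character `χ : G → ℂˣ` trivial on `H` Kato's `χ`-part `E(K)^(χ)` is
torsion, then `rank_ℤ E(F) = rank_ℤ E(ℚ)`: indeed
`rank E(ℚ) ≤ rank E(F) ≤ rank E(K)^H = rank E(K)^G = rank E(ℚ)`, the middle equality being
`finrank_fixed_eq_finrank_fixed_of_subgroup` and the last one Galois descent of points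
(`E(K)^G` is the image of `E(ℚ)` since `K^G = ℚ`). All groups of points are finitely generated by
the Mordell–Weil theorem. [folklore] -/
theorem mordellWeilRank_fixedField_eq_of_chiPart_torsion (W : WeierstrassCurve ℚ) [W.IsElliptic]
    (m : ℕ) [NeZero m] (H : Subgroup (CyclotomicField m ℚ ≃ₐ[ℚ] CyclotomicField m ℚ))
    (htors : ∀ χ : (CyclotomicField m ℚ ≃ₐ[ℚ] CyclotomicField m ℚ) →* ℂˣ, (∀ h ∈ H, χ h = 1) →
      χ ≠ 1 → ∀ x ∈ chiPart
        (fun σ : CyclotomicField m ℚ ≃ₐ[ℚ] CyclotomicField m ℚ =>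
          Point.map (W' := W.toAffine) (σ : CyclotomicField m ℚ →ₐ[ℚ] CyclotomicField m ℚ))
        (fun σ => (χ σ : ℂ)), IsOfFinAddOrder x) :
    (W.baseChange ↥(IntermediateField.fixedField H)).mordellWeilRank = W.mordellWeilRank := by
  -- the fields (`Gal(K/ℚ)` is a `CommGroup` through the scoped `IsMulCommutative` instance)
  haveI : IsGalois ℚ (CyclotomicField m ℚ) := isGalois_cyclotomicField m
  haveI : IsMulCommutative (CyclotomicField m ℚ ≃ₐ[ℚ] CyclotomicField m ℚ) :=
    isMulCommutative_gal_cyclotomicField m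
  set F : IntermediateField ℚ (CyclotomicField m ℚ) := IntermediateField.fixedField H with hF
  letI : NumberField F := NumberField.mk
  -- the group laws on `E(F)`, `E(ℚ)` must be elaborated against the classical `DecidableEq`, as
  -- inside `WeierstrassCurve.mordellWeilRank` (`↥F` and `ℚ` offer other instances)
  letI : DecidableEq F := fun a b => Classical.propDecidable (a = b)
  letI : DecidableEq ℚ := fun a b => Classical.propDecidable (a = b)
  -- the curves and their Mordell–Weil groups
  haveI : (W.baseChange (CyclotomicField m ℚ)).IsElliptic :=
    inferInstanceAs (W.map (algebraMap ℚ (CyclotomicField m ℚ))).IsElliptic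
  haveI : Module.Finite ℤ (W.baseChange (CyclotomicField m ℚ)).toAffine.Point :=
    (W.baseChange (CyclotomicField m ℚ)).module_finite_point_holds
  haveI : (W.baseChange F).IsElliptic := inferInstanceAs (W.map (algebraMap ℚ F)).IsElliptic
  haveI : Module.Finite ℤ (W.baseChange F).toAffine.Point := (W.baseChange F).module_finite_point_holds
  -- the Galois action on `E(K)`
  set ρ : (CyclotomicField m ℚ ≃ₐ[ℚ] CyclotomicField m ℚ) →
      (W.baseChange (CyclotomicField m ℚ)).toAffine.Point →+
        (W.baseChange (CyclotomicField m ℚ)).toAffine.Point :=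
    fun σ => Point.map (W' := W.toAffine) (σ : CyclotomicField m ℚ →ₐ[ℚ] CyclotomicField m ℚ)
    with hρ
  have hmul : ∀ (σ τ : CyclotomicField m ℚ ≃ₐ[ℚ] CyclotomicField m ℚ)
      (P : (W.baseChange (CyclotomicField m ℚ)).toAffine.Point), ρ (σ * τ) P = ρ σ (ρ τ P) :=
    fun σ τ P => by rcases P with _ | ⟨x, y, h⟩ <;> rfl
  have hone : ∀ P : (W.baseChange (CyclotomicField m ℚ)).toAffine.Point, ρ 1 P = P :=
    fun P => by rcases P with _ | ⟨x, y, h⟩ <;> rfl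
  -- `E(ℚ) → E(K)` and its range `E(K)^G`
  set ι₀ : (W.baseChange ℚ).toAffine.Point →+ (W.baseChange (CyclotomicField m ℚ)).toAffine.Point :=
    Point.map (W' := W.toAffine) (Algebra.ofId ℚ (CyclotomicField m ℚ)) with hι₀
  have hι₀ρ : ∀ (σ : CyclotomicField m ℚ ≃ₐ[ℚ] CyclotomicField m ℚ)
      (Q : (W.baseChange ℚ).toAffine.Point), ρ σ (ι₀ Q) = ι₀ Q := fun σ Q => by
    rw [hρ, hι₀, Point.map_map, Subsingleton.elim ((σ : CyclotomicField m ℚ →ₐ[ℚ] _).comp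
      (Algebra.ofId ℚ (CyclotomicField m ℚ))) (Algebra.ofId ℚ (CyclotomicField m ℚ))]
  set MG : Submodule ℤ (W.baseChange (CyclotomicField m ℚ)).toAffine.Point :=
    LinearMap.range ι₀.toIntLinearMap with hMGdef
  have hMG : ∀ P, P ∈ MG ↔ ∀ σ, ρ σ P = P := by
    intro P
    constructor
    · rintro ⟨Q, rfl⟩ σ
      exact hι₀ρ σ Q
    · intro hP
      rcases P with _ | ⟨x, y, hxy⟩
      · exact ⟨0, map_zero _⟩
      · have hfix : ∀ z : CyclotomicField m ℚ, (∀ σ : CyclotomicField m ℚ ≃ₐ[ℚ] _, σ z = z) →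
            ∃ q : ℚ, algebraMap ℚ (CyclotomicField m ℚ) q = z := fun z hz => by
          have hz' : z ∈ (⊥ : IntermediateField ℚ (CyclotomicField m ℚ)) := by
            rw [← IsGalois.fixedField_top]
            exact (IntermediateField.mem_fixedField_iff ⊤ z).mpr fun σ _ => hz σ
          exact IntermediateField.mem_bot.mp hz'
        have hxy' : ∀ σ : CyclotomicField m ℚ ≃ₐ[ℚ] CyclotomicField m ℚ, σ x = x ∧ σ y = y := by
          intro σ
          have h := hP σ
          rw [hρ, Point.map_some] at h
          simpa using h
        obtain ⟨x₀, rfl⟩ := hfix x fun σ => (hxy' σ).1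
        obtain ⟨y₀, rfl⟩ := hfix y fun σ => (hxy' σ).2
        have h₀ : (W.baseChange ℚ).toAffine.Nonsingular x₀ y₀ :=
          (baseChange_nonsingular (W := W.toAffine) (f := Algebra.ofId ℚ (CyclotomicField m ℚ))
            (Algebra.ofId ℚ (CyclotomicField m ℚ)).injective x₀ y₀).mp hxy
        exact ⟨Point.some x₀ y₀ h₀, rfl⟩
  have hι₀inj : Function.Injective ι₀.toIntLinearMap :=
    Point.map_injective (W' := W.toAffine) (Algebra.ofId ℚ (CyclotomicField m ℚ))
  have hB : Module.finrank ℤ MG = Module.finrank ℤ (W.baseChange ℚ).toAffine.Point :=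
    LinearMap.finrank_range_of_inj hι₀inj
  -- `E(K)^H` and `E(F) → E(K)^H`
  let MH : Submodule ℤ (W.baseChange (CyclotomicField m ℚ)).toAffine.Point :=
    { carrier := {P | ∀ h ∈ H, ρ h P = P}
      add_mem' := fun {a b} ha hb h hh => by rw [map_add, ha h hh, hb h hh]
      zero_mem' := fun h _ => map_zero _
      smul_mem' := fun c {P} hP h hh => by rw [map_zsmul, hP h hh] }
  have hMH : ∀ P, P ∈ MH ↔ ∀ h ∈ H, ρ h P = P := fun P => Iff.rfl
  set ιF : (W.baseChange F).toAffine.Point →+ (W.baseChange (CyclotomicField m ℚ)).toAffine.Point :=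
    Point.map (W' := W.toAffine) (F.val) with hιF
  have hιFH : ∀ P, ιF P ∈ MH := by
    intro P h hh
    show ρ h (ιF P) = ιF P
    have hcomp : (h : CyclotomicField m ℚ →ₐ[ℚ] CyclotomicField m ℚ).comp F.val = F.val :=
      AlgHom.ext fun z =>
        (IntermediateField.mem_fixedField_iff H (z : CyclotomicField m ℚ)).mp (hF ▸ z.2) h hh
    rw [hρ, hιF, Point.map_map, hcomp]
  have hA : Module.finrank ℤ (W.baseChange F).toAffine.Point ≤ Module.finrank ℤ MH :=
    LinearMap.finrank_le_finrank_of_injective (f := ιF.toIntLinearMap.codRestrict MH hιFH)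
      fun P Q hPQ => Point.map_injective (W' := W.toAffine) F.val
        (congrArg Subtype.val hPQ :)
  -- `E(ℚ) → E(F)`
  have hC : Module.finrank ℤ (W.baseChange ℚ).toAffine.Point ≤
      Module.finrank ℤ (W.baseChange F).toAffine.Point :=
    LinearMap.finrank_le_finrank_of_injective
      (f := (Point.map (W' := W.toAffine) (Algebra.ofId ℚ F)).toIntLinearMap)
      (Point.map_injective (W' := W.toAffine) (Algebra.ofId ℚ F))
  -- the rank algebra
  have hrank : Module.finrank ℤ MH = Module.finrank ℤ MG :=
    finrank_fixed_eq_finrank_fixed_of_subgroup ρ hmul hone H htors MH hMH MG hMG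
  -- assemble (`W.baseChange ℚ = W` definitionally)
  apply le_antisymm
  · calc (W.baseChange F).mordellWeilRank = Module.finrank ℤ (W.baseChange F).toAffine.Point := rfl
      _ ≤ Module.finrank ℤ MH := hA
      _ = Module.finrank ℤ MG := hrank
      _ = Module.finrank ℤ (W.baseChange ℚ).toAffine.Point := hB
      _ = W.mordellWeilRank := rfl
  · calc W.mordellWeilRank = Module.finrank ℤ (W.baseChange ℚ).toAffine.Point := rfl
      _ ≤ Module.finrank ℤ (W.baseChange F).toAffine.Point := hC
      _ = (W.baseChange F).mordellWeilRank := rfl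

end KatoDescent

end Summit.BirchSwinnertonDyer.BirchSwinnertonDyer.Theorems

end
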